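import Summits.QuantumFields.BalabanUV.Beta.GAN24.LinT2CoDressedStep
import Summits.QuantumFields.BalabanUV.Beta.GAN24.Lin4ZeroMode
import Summits.QuantumFields.BalabanUV.Beta.AxialDressingRootedBmHessian

/-!
# `BalabanUV.Beta.GAN24.DressedStepCharge` — binder row G-an2-4 / (CONV-C), W-slot CT-W, route (R-DEV) of RULING R-gan24p1-g23-1 (journal l.37889): **THE EXACT
# ONE-STEP CHARGE LAW OF THE DRESSED COMB STEP AND THE `j`-FREENESS OF ITS CHARGE MAP** — for every jointly `Lc`-covariant `LocStencil₂` table `X`, every in-block root,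
# `zmode N (𝒜^E_j X) = N^{d+1}·c·½·Lc^{−4(d+2)}·(zmode Lc (𝔇X) μν + zmode Lc (𝔇X) νμ)` (the dressed step reads the cell charge of the DRESSED TABLE `𝔇X`, `j`-free), hence
# `zmode N ((𝒜^E_i − 𝒜^E_j) X) = 0` — NO hypothesis on the charge of `X`: the transport half of the deviation tower's forcing `(𝒜^E_{m+1} − 𝒜^E_m) D_m + (g′_{m+1} − g′_m)`
# is cell-charge-free whatever `D_m` is ((W4)(ii) of the OWNER gan24-p1 g23, l.37785 ∕ l.37889, transport half)

NOT IN PRINT; OUR BOOKKEEPING ([folklore] leaf-06 g42's `LinT2CoDressedStep.lin4_comb_coDressKBmAt` (`𝒜^E_j X = 𝒜^B_j (𝔇X)`) + leaf-18∕leaf-02's `Lin4ZeroMode.zmode_lin4_step` ∕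
`zmode_lin4_sub_lin4_step` at the dressed table `𝔇X`, which is `LocStencil₂` (leaf-06's `locStencil₂_coProj_snd ∕ _fst ∕ _dress`) and jointly covariant (leaf-06's
`translate_dress`); G-an2-4 formalisation swarm, leaf prover `b2b-balaban-gan24-formalise-leaf-01`, gen 62; «MINE (W4)» journal l.37955; name PROVISIONAL).
HONEST FRAMING (cell contract, verbatim): «discharging `BetaPertH` makes Bałaban's UV stability UNCONDITIONAL — a real constructive-QFT result; it is NOT the continuum
limit and NOT the Clay problem.»  HONEST DEPENDENCY (verbatim): «continuum YM on T⁴ ⇐ BetaPertH ∧ nine spine estimates (0/9 proved); BetaPertH ⇐ (D1) ∧ (D4) ∧ CAP+tail;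
G-an2-4 gates asym, D1 and NE2/3/4.»

## What (generic `d`; `Lc ≥ 1` a `NeZero`; in-block root `ρ = toSite r`, `r ∈ box (d+1) Lc`; `Ĝ_j := coDressKBmAt ρ Lc (KInvStep Lc j)`, `𝒜^E_j := lin4 c (unitK_j Ĝ_j) Lc`,
## `𝔇X κ u κ′ u′ := dressKBmAt ρ Lc (coProjBmAtK ρ Lc (κ₁ u₁ ↦ coProjBmAtK ρ Lc (X κ₁ u₁) κ′ u′) κ u)`)
* §1 `locStencil₂_dressTab` — `LocStencil₂ X C δ → LocStencil₂ (𝔇X) (cKb²·(cWb·e^{3δ(d+1)Lc})·cKb·C) δ` (leaf-06's three one-slot lemmas composed; ONE constant);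
  `dressTab_translate` — `𝔇X` is jointly `Lc`-covariant when `X` is (leaf-06's `translate_dress`, restated for the literal used below);
  `shiftK_unitK_coDressKBmAt_KInvStep` — the dressed unit kernel is `Lc`-shift invariant (leaf-18's `shiftK_unitK` + asym1's `shiftK_coDressKBmAt_KInvStep`);
  `lin4_dressed_translate` — `𝒜^E_j X` is PERIOD-1 covariant on the coarse lattice (`Lin4ZeroMode.lin4_translate`).
* §2 **`zmode_lin4_dressed_step`** — the EXACT one-step charge law of the dressed step at any read-out period `N`:
  `zmode N (𝒜^E_j X) μ ν ff = N^{d+1}·(c·(½·(Lc^{d+2})⁻⁴))·(zmode Lc (𝔇X) μ ν ff + zmode Lc (𝔇X) ν μ ff)` — `j`-FREE (the numeric face of the OWNER's (N1): the dressed step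
  multiplies the charge map of `X` by the four-face read-out of `𝔇`, leaf-02 g52's F-leaf02-g52-1).
* §3 **`zmode_lin4_dressed_sub_lin4_dressed`** — `zmode N (𝒜^E_i X − 𝒜^E_j X) μ ν ff = 0` for ALL steps `i j` and every jointly covariant `LocStencil₂` `X` — no pin, no hypothesis on
  the charge of `X`; **`zfreeSym_lin4_dressed_sub`** — the same packaged with the period-`Lc` covariance of the difference (the `ZfreeSym` text of road W3's `TransportRows`).
Asserts NO shape of Bałaban's tables; discharges NOTHING of (Z′) ∕ (F3ᴱ-irr) ∕ «T2Shape» ∕ «T2Drift» ∕ (hW, hWall); NOT «W-slot closed», NEVER «G-an2-4 closed» as (CONV-C); NOT D1,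
NOT `BetaPertH`, NOT continuum, NOT Clay.  0 cited facts, 0 `def`, 0 `def … : Prop`, 0 sorry.
-/

noncomputable section

open Finset
open scoped BigOperators
open Literature.MathematicalPhysics.QuantumFieldTheory
open Literature.MathematicalPhysics.QuantumFieldTheory.Balaban1983to89
open Literature.MathematicalPhysics.QuantumFieldTheory.Balaban1983to89.Beta
open ExpKernelCalculus (MKer Decays shiftK)
open OneStepResolventKernel (Fib decays_mono)
open OneStepKernelFamily (KInvStep decays_KInvStep)
open AffineAveraging (box toSite)
open BalabanCompositeJets (LocStencil₂)
open Summit.QuantumFields.BalabanUV.Beta.HessKerDressedUnits (unitK decays_unitK)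
open Summit.QuantumFields.BalabanUV.Beta.AxialDressingRooted (coDressKBmAt dressKBmAt coProjBmAtK cKb cWb shiftK_coDressKBmAt_KInvStep)
open Summit.QuantumFields.BalabanUV.Beta.GAN24.CombesThomas (sfStep smStep)
open Summit.QuantumFields.BalabanUV.Beta.GAN24.T2RecursionAffine (lin4)
open Summit.QuantumFields.BalabanUV.Beta.GAN24.BiStencilZeroMode (Tab zmode)
open Summit.QuantumFields.BalabanUV.Beta.GAN24.LinT2ZeroModeStep (shiftK_unitK)
open Summit.QuantumFields.BalabanUV.Beta.GAN24.Lin4ZeroMode (lin4_translate zmode_lin4_step zmode_lin4_sub_lin4_step)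
open Summit.QuantumFields.BalabanUV.Beta.GAN24.LinT2CoDressed (locStencil₂_coProj_snd locStencil₂_coProj_fst locStencil₂_dress)
open Summit.QuantumFields.BalabanUV.Beta.GAN24.LinT2CoDressedStep (lin4_comb_coDressKBmAt translate_dress)

namespace Summit.QuantumFields.BalabanUV.Beta.GAN24.DressedStepCharge

variable {d : ℕ} {Lc : ℕ} [NeZero Lc] {r : Fin (d + 1) → ℕ}

/-! ## §1 The dressed table: envelope and covariance; the dressed unit kernel and step: covariance -/

omit [NeZero Lc] in
/-- [folklore] **THE DRESSED TABLE OF A `LocStencil₂` TABLE IS `LocStencil₂` AT THE SAME RATE**, one constant (leaf-06 g42's `locStencil₂_coProj_snd` → `_coProj_fst` → `_dress`). -/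
theorem locStencil₂_dressTab (hLc : 1 ≤ Lc) (hr : r ∈ box (d + 1) Lc) {X : Tab d} {C δ : ℝ} (hX : LocStencil₂ X C δ) (hδ : 0 ≤ δ) :
    LocStencil₂ (fun κ u κ' u' => dressKBmAt (toSite r) Lc (coProjBmAtK (toSite r) Lc (fun κ₁ u₁ => coProjBmAtK (toSite r) Lc (X κ₁ u₁) κ' u') κ u))
      (cKb d Lc δ * cKb d Lc δ * (cWb d Lc * Real.exp (3 * δ * (((d : ℝ) + 1) * Lc)) * (cKb d Lc δ * C))) δ :=
  locStencil₂_dress hLc hr (locStencil₂_coProj_fst hLc hr (locStencil₂_coProj_snd hLc hr hX hδ) hδ) hδ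

omit [NeZero Lc] in
/-- [folklore] **THE DRESSED TABLE OF A JOINTLY `Lc`-COVARIANT TABLE IS JOINTLY `Lc`-COVARIANT** (leaf-06 g42's `translate_dress`, in the binder shape of `Lin4ZeroMode`). -/
theorem dressTab_translate (hLc : 1 ≤ Lc) {X : Tab d}
    (hXcov : ∀ κ u κ' u' t, X κ (u + (Lc : ℤ) • t) κ' (u' + (Lc : ℤ) • t) = shiftK (-((Lc : ℤ) • t)) (X κ u κ' u')) :
    ∀ κ u κ' u' t, (fun κ u κ' u' => dressKBmAt (toSite r) Lc (coProjBmAtK (toSite r) Lc (fun κ₁ u₁ => coProjBmAtK (toSite r) Lc (X κ₁ u₁) κ' u') κ u))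
        κ (u + (Lc : ℤ) • t) κ' (u' + (Lc : ℤ) • t)
      = shiftK (-((Lc : ℤ) • t))
        ((fun κ u κ' u' => dressKBmAt (toSite r) Lc (coProjBmAtK (toSite r) Lc (fun κ₁ u₁ => coProjBmAtK (toSite r) Lc (X κ₁ u₁) κ' u') κ u)) κ u κ' u') :=
  fun κ u κ' u' t => translate_dress (toSite r) hLc hXcov κ u κ' u' t

/-- [folklore] **THE DRESSED UNIT KERNEL IS `Lc`-SHIFT INVARIANT** (leaf-18's `shiftK_unitK` + asym1's `shiftK_coDressKBmAt_KInvStep`). -/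
theorem shiftK_unitK_coDressKBmAt_KInvStep (ρ : Fin (d + 1) → ℤ) (j : ℕ) (t : Fin (d + 1) → ℤ) :
    shiftK (-((Lc : ℤ) • t)) (unitK (sfStep Lc j) (smStep d Lc j) (coDressKBmAt ρ Lc (KInvStep (d := d) Lc j)))
      = unitK (sfStep Lc j) (smStep d Lc j) (coDressKBmAt ρ Lc (KInvStep (d := d) Lc j)) := by
  rw [shiftK_unitK, shiftK_coDressKBmAt_KInvStep]

/-- [folklore] **THE DRESSED STEP's OUTPUT IS PERIOD-1 COVARIANT ON THE COARSE LATTICE** (`Lin4ZeroMode.lin4_translate` at the dressed unit kernel). -/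
theorem lin4_dressed_translate (ρ : Fin (d + 1) → ℤ) (j : ℕ) (c : ℝ) {X : Tab d}
    (hXcov : ∀ κ u κ' u' t, X κ (u + (Lc : ℤ) • t) κ' (u' + (Lc : ℤ) • t) = shiftK (-((Lc : ℤ) • t)) (X κ u κ' u'))
    (μ : Fin (d + 1)) (y : Fin (d + 1) → ℤ) (ν : Fin (d + 1)) (y' t : Fin (d + 1) → ℤ) :
    lin4 c (unitK (sfStep Lc j) (smStep d Lc j) (coDressKBmAt ρ Lc (KInvStep (d := d) Lc j))) Lc X μ (y + t) ν (y' + t)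
      = shiftK (-t) (lin4 c (unitK (sfStep Lc j) (smStep d Lc j) (coDressKBmAt ρ Lc (KInvStep (d := d) Lc j))) Lc X μ y ν y') :=
  lin4_translate (shiftK_unitK_coDressKBmAt_KInvStep ρ j) c hXcov μ y ν y' t

/-! ## §2 The exact one-step charge law of the dressed comb step -/

/-- NOT IN PRINT; OUR BOOKKEEPING ([folklore] leaf-06's `lin4_comb_coDressKBmAt` + `Lin4ZeroMode.zmode_lin4_step` at the dressed table).  **THE EXACT ONE-STEP CHARGE LAW OF
THE DRESSED COMB STEP**, read-out period `N`, every step `j`, every scalar `c`, every jointly `Lc`-covariant `LocStencil₂` table `X` (rate `δ > 0`):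
`zmode N (𝒜^E_j X) μ ν (inl α) (inl β) = N^{d+1} · (c · (½ · ((Lc^{d+2})⁻¹)^4) · (zmode Lc (𝔇X) μ ν (inl α) (inl β) + zmode Lc (𝔇X) ν μ (inl α) (inl β)))` — `j`-FREE;
the dressed step reads the bond-symmetrised cell charge of the DRESSED table (the four-face read-out of `X`, leaf-02 g52's F-leaf02-g52-1), not of `X`. -/
theorem zmode_lin4_dressed_step (hr : r ∈ box (d + 1) Lc) (N j : ℕ) (c : ℝ) {X : Tab d} {CT δ : ℝ} (hX : LocStencil₂ X CT δ) (hδ : 0 < δ)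
    (hXcov : ∀ κ u κ' u' t, X κ (u + (Lc : ℤ) • t) κ' (u' + (Lc : ℤ) • t) = shiftK (-((Lc : ℤ) • t)) (X κ u κ' u'))
    (μ ν α β : Fin (d + 1)) :
    zmode N (lin4 c (unitK (sfStep Lc j) (smStep d Lc j) (coDressKBmAt (toSite r) Lc (KInvStep (d := d) Lc j))) Lc X) μ ν (Sum.inl α) (Sum.inl β)
      = ((N : ℝ) ^ (d + 1)) * (c * ((1 / 2 : ℝ) * (((Lc : ℝ) ^ (d + 1 + 1))⁻¹) ^ 4) *
          (zmode Lc (fun κ u κ' u' => dressKBmAt (toSite r) Lc (coProjBmAtK (toSite r) Lc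
                (fun κ₁ u₁ => coProjBmAtK (toSite r) Lc (X κ₁ u₁) κ' u') κ u)) μ ν (Sum.inl α) (Sum.inl β)
            + zmode Lc (fun κ u κ' u' => dressKBmAt (toSite r) Lc (coProjBmAtK (toSite r) Lc
                (fun κ₁ u₁ => coProjBmAtK (toSite r) Lc (X κ₁ u₁) κ' u') κ u)) ν μ (Sum.inl α) (Sum.inl β))) := by
  have hLc : 1 ≤ Lc := Nat.one_le_iff_ne_zero.mpr (NeZero.ne Lc)
  rw [lin4_comb_coDressKBmAt hr j hX hδ c]
  exact zmode_lin4_step hLc N j c (locStencil₂_dressTab hLc hr hX hδ.le) hδ (dressTab_translate hLc hXcov) μ ν α β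

/-! ## §3 The charge map of the dressed step is `j`-free: step differences are cell-charge-free on EVERY table -/

/-- NOT IN PRINT; OUR BOOKKEEPING ([folklore] leaf-06's `lin4_comb_coDressKBmAt` twice — the dressed table `𝔇X` does NOT depend on the step — + `Lin4ZeroMode.zmode_lin4_sub_lin4_step`).
**THE DIFFERENCE OF TWO DRESSED COMB STEPS ON ONE TABLE IS CELL-CHARGE-FREE AT EVERY PERIOD**: for all steps `i j`, every `c`, every jointly `Lc`-covariant `LocStencil₂` `X`,
`zmode N (𝒜^E_i X − 𝒜^E_j X) μ ν (inl α) (inl β) = 0` — no pin, no hypothesis on the charge of `X` (the transport half of the deviation tower's difference forcing, (W4)(ii)). -/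
theorem zmode_lin4_dressed_sub_lin4_dressed (hr : r ∈ box (d + 1) Lc) (N i j : ℕ) (c : ℝ) {X : Tab d} {CT δ : ℝ} (hX : LocStencil₂ X CT δ) (hδ : 0 < δ)
    (hXcov : ∀ κ u κ' u' t, X κ (u + (Lc : ℤ) • t) κ' (u' + (Lc : ℤ) • t) = shiftK (-((Lc : ℤ) • t)) (X κ u κ' u'))
    (μ ν α β : Fin (d + 1)) :
    zmode N (lin4 c (unitK (sfStep Lc i) (smStep d Lc i) (coDressKBmAt (toSite r) Lc (KInvStep (d := d) Lc i))) Lc X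
        - lin4 c (unitK (sfStep Lc j) (smStep d Lc j) (coDressKBmAt (toSite r) Lc (KInvStep (d := d) Lc j))) Lc X) μ ν (Sum.inl α) (Sum.inl β) = 0 := by
  have hLc : 1 ≤ Lc := Nat.one_le_iff_ne_zero.mpr (NeZero.ne Lc)
  rw [lin4_comb_coDressKBmAt hr i hX hδ c, lin4_comb_coDressKBmAt hr j hX hδ c]
  exact zmode_lin4_sub_lin4_step hLc N i j c (locStencil₂_dressTab hLc hr hX hδ.le) hδ (dressTab_translate hLc hXcov) μ ν α β

/-- [folklore] **COVARIANCE OF THE STEP DIFFERENCE** at period `Lc` (from the period-1 covariance of each dressed step, `lin4_dressed_translate`, at `t ↦ Lc•t`). -/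
theorem lin4_dressed_sub_translate (i j : ℕ) (c : ℝ) {X : Tab d}
    (hXcov : ∀ κ u κ' u' t, X κ (u + (Lc : ℤ) • t) κ' (u' + (Lc : ℤ) • t) = shiftK (-((Lc : ℤ) • t)) (X κ u κ' u'))
    (μ : Fin (d + 1)) (y : Fin (d + 1) → ℤ) (ν : Fin (d + 1)) (y' t : Fin (d + 1) → ℤ) :
    (lin4 c (unitK (sfStep Lc i) (smStep d Lc i) (coDressKBmAt (toSite r) Lc (KInvStep (d := d) Lc i))) Lc X
        - lin4 c (unitK (sfStep Lc j) (smStep d Lc j) (coDressKBmAt (toSite r) Lc (KInvStep (d := d) Lc j))) Lc X) μ (y + (Lc : ℤ) • t) ν (y' + (Lc : ℤ) • t)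
      = shiftK (-((Lc : ℤ) • t)) ((lin4 c (unitK (sfStep Lc i) (smStep d Lc i) (coDressKBmAt (toSite r) Lc (KInvStep (d := d) Lc i))) Lc X
        - lin4 c (unitK (sfStep Lc j) (smStep d Lc j) (coDressKBmAt (toSite r) Lc (KInvStep (d := d) Lc j))) Lc X) μ y ν y') := by
  funext x z a b
  simp only [shiftK, Pi.sub_apply, lin4_dressed_translate (toSite r) i c hXcov μ y ν y' ((Lc : ℤ) • t),
    lin4_dressed_translate (toSite r) j c hXcov μ y ν y' ((Lc : ℤ) • t)]

/-- NOT IN PRINT; OUR BOOKKEEPING.  **THE STEP DIFFERENCE IS `ZfreeSym`** (the text of road W3's `TransportRows.transport_rows_three_symZ`: jointly `Lc`-covariant ∧ bond-symmetrised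
ff cell charge zero) — for EVERY jointly `Lc`-covariant `LocStencil₂` input, whatever its own charge. -/
theorem zfreeSym_lin4_dressed_sub (hr : r ∈ box (d + 1) Lc) (i j : ℕ) (c : ℝ) {X : Tab d} {CT δ : ℝ} (hX : LocStencil₂ X CT δ) (hδ : 0 < δ)
    (hXcov : ∀ κ u κ' u' t, X κ (u + (Lc : ℤ) • t) κ' (u' + (Lc : ℤ) • t) = shiftK (-((Lc : ℤ) • t)) (X κ u κ' u')) :
    (∀ (κ : Fin (d + 1)) (u : Fin (d + 1) → ℤ) (κ' : Fin (d + 1)) (u' t : Fin (d + 1) → ℤ),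
        (lin4 c (unitK (sfStep Lc i) (smStep d Lc i) (coDressKBmAt (toSite r) Lc (KInvStep (d := d) Lc i))) Lc X
            - lin4 c (unitK (sfStep Lc j) (smStep d Lc j) (coDressKBmAt (toSite r) Lc (KInvStep (d := d) Lc j))) Lc X) κ (u + (Lc : ℤ) • t) κ' (u' + (Lc : ℤ) • t)
          = shiftK (-((Lc : ℤ) • t)) ((lin4 c (unitK (sfStep Lc i) (smStep d Lc i) (coDressKBmAt (toSite r) Lc (KInvStep (d := d) Lc i))) Lc X
            - lin4 c (unitK (sfStep Lc j) (smStep d Lc j) (coDressKBmAt (toSite r) Lc (KInvStep (d := d) Lc j))) Lc X) κ u κ' u')) ∧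
      (∀ κ κ' κ₁ κ₂ : Fin (d + 1),
        zmode Lc (lin4 c (unitK (sfStep Lc i) (smStep d Lc i) (coDressKBmAt (toSite r) Lc (KInvStep (d := d) Lc i))) Lc X
            - lin4 c (unitK (sfStep Lc j) (smStep d Lc j) (coDressKBmAt (toSite r) Lc (KInvStep (d := d) Lc j))) Lc X) κ κ' (Sum.inl κ₁) (Sum.inl κ₂)
          + zmode Lc (lin4 c (unitK (sfStep Lc i) (smStep d Lc i) (coDressKBmAt (toSite r) Lc (KInvStep (d := d) Lc i))) Lc X
            - lin4 c (unitK (sfStep Lc j) (smStep d Lc j) (coDressKBmAt (toSite r) Lc (KInvStep (d := d) Lc j))) Lc X) κ' κ (Sum.inl κ₁) (Sum.inl κ₂) = 0) :=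
  ⟨fun κ u κ' u' t => lin4_dressed_sub_translate i j c hXcov κ u κ' u' t, fun κ κ' κ₁ κ₂ => by
    rw [zmode_lin4_dressed_sub_lin4_dressed hr Lc i j c hX hδ hXcov κ κ' κ₁ κ₂,
      zmode_lin4_dressed_sub_lin4_dressed hr Lc i j c hX hδ hXcov κ' κ κ₁ κ₂, add_zero]⟩

end Summit.QuantumFields.BalabanUV.Beta.GAN24.DressedStepCharge

end
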